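import Literature.NumberTheory.IwasawaTheory.CyclotomicTwoTotallyRamifiedEvenIndexCertificate
import Mathlib.NumberTheory.RamificationInertia.Galois
import Mathlib.NumberTheory.RamificationInertia.HilbertTheory
import Mathlib.FieldTheory.Galois.IsGaloisGroup
import Mathlib.NumberTheory.NumberField.Basic
import HarnessLib

/-!
# Route `AlignedTransportAtTwo`, crux C2 `MainConjectureOfRankZeroBSDAtTwo` (stmt-BirchSwinnertonDyer-22298):
# TOOLS FOR FUKUDA'S INDEX OFF THE STRATUM — (1) `√2, √D ∈ N`, `D ≡ 3 (mod 4)` ⟹ `4 ∣ e(𝔔|2)`; (2) `#I_𝔔 = e` and the PRODUCT INEQUALITY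
# `e(𝔔|𝔔∩L)·e(𝔔|𝔔∩T) ≤ e(𝔔|𝔔∩F)` for two subextensions generating a Galois `M/F`; (3) transport of `e(·|2)` along `𝓞_K ≃ 𝓞_L`

HONEST FRAMING (cell `bsd-f1-sign2`, WIDTH-5 attached prover seat `bsd-line-att-p5` gen 28 on line `birth` of the lead `bsd-line-att-p2`;
`--supports` stmt-BirchSwinnertonDyer-22298, closes nothing; BSD is NOT proved by any of this; the crux C2, its verdict «blocked-on
`Rank1Residual.GreenbergMuConjectureIrreducible`» and every registered stub are untouched). THEOREMS ONLY — no definition, no named fact,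
no `sorry`; pure number-field statements (no elliptic curve appears in this file). Purpose (sequel `…CubicOffStratumFukudaIndexTransfer`,
`…CubicOffStratumFukudaIndex`): att-p5 g27 decided the ramification bit of the OFF-stratum doors («every prime of `ℚ(β)` above `2` has odd index ⟺
`Δ_min ≡ 1 (mod 4)`»); on `Δ_min ≡ 3 (mod 4)` the cubic field `ℚ(β)` has a prime `𝔭₂` with `(e, f) = (2, 1)` and the structural binder
`TotallyRamifiedFrom κ 0` of the Fukuda / Chevalley doors (bsd-2adic, att-p4 g24 `…CubicRankDoorAnyStratum`) asks whether `𝔭₂` ramifies AGAIN in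
`ℚ(β)(√2)`. Counting `e, f, g` in `ℚ(β, √2, √Δ)` and its subfields provably cannot decide this (the false alternative «`𝔭₂` splits in `ℚ(β)(√2)`» is
the `√2 ↔ √Δ` swap of the true picture); the decision needs the INERTIA GROUP. The three tools, all for general number fields:

* §1 `even_ramificationIdx_of_sq_eq_two_mul` (`x² = 2y`, `y ∉ 𝔔` ⟹ `e(𝔔|2)` even); **`even_ramificationIdx_of_sq_eq_intCast_of_emod_four_eq_three`**
  (`δ² = D ≡ 3 (4)` ⟹ `e(𝔔|2)` even: `(1+δ)² = 2(δ + (1+D)/2)`); **`four_dvd_ramificationIdx_of_sq_eq_two_of_sq_eq_intCast`** (`θ² = 2`, `δ² = D ≡ 3 (4)`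
  ⟹ `4 ∣ e(𝔔|2)`: `ξ = θ(1+δ)/2` is integral, `(ξ−1)² = θ·(ξ(1−θ) + θ(1+D)/4)` with the cofactor outside `𝔔`, and bsd-2adic's local certificate
  `four_dvd_ramificationIdx_of_sq_eq_mul` fires) — i.e. `ℚ₂(√2, √D)/ℚ₂` is totally ramified biquadratic, in completion-free form.
* §2 `card_inertia_eq_ramificationIdx` (`#I_𝔔(Gal(M/K)) = e(𝔔|𝔔∩K)`, Mathlib's Hilbert theory `Ideal.card_inertia_eq_ramificationIdxIn`),
  `restrictScalars_mem_inertia`, **`ramificationIdx_mul_ramificationIdx_le_of_generate`**: `M/F` Galois, `L, T` subextensions such that only `1` fixes both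
  ⟹ `e(𝔔|𝔔∩L)·e(𝔔|𝔔∩T) ≤ e(𝔔|𝔔∩F)` (the restriction maps `I_L × I_T → I_F`, `(σ,τ) ↦ στ`, are injective since `Gal(M/L) ∩ Gal(M/T) = 1`).
* §3 `ramificationIdx_int_map_ringEquiv`, **`forall_ramificationIdx_le_of_ringEquiv`**: transport of `e(·|2)` (and of a bound on it) along a ring
  isomorphism `𝓞_K ≃ 𝓞_L` — phrased on the rings of integers (cf. the tree's `ramificationIdx_int_map_mapAlgEquiv`, phrased with `K ≃ₐ[F] L`).

References: [NeukirchANT1999] Ch. I §8 Prop. (8.2), §9 Prop. (9.4), (9.6) (inertia group, `#I = e`); [Washington1997] §13.1; [Marcus2018] Ch. 4 (e, f in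
normal extensions); Mathlib `NumberTheory/RamificationInertia/Galois` (2026: `card_inertia_eq_ramificationIdxIn`).
-/

set_option linter.dupNamespace false
set_option autoImplicit false

noncomputable section

open scoped NumberField
open Polynomial UniqueFactorizationMonoid NumberField IsDedekindDomain

namespace Summit.BirchSwinnertonDyer.BirchSwinnertonDyer.Theorems.AlignedTransportAtTwoCubicOffStratumFukudaIndexTools

open Literature.NumberTheory.IwasawaTheory

/-! ## §1 Element certificates for the parity / `4`-divisibility of `e(𝔔|2)` -/

section Elements

variable {N : Type*} [Field N] [NumberField N]

/-- **`x² = 2y` with `y ∉ 𝔔` forces `e(𝔔|2)` even.** In the factorisation of `2𝓞_N` the exponent of a prime `𝔔 ∋ 2` is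
`2·v_𝔔(x) − v_𝔔(y) = 2 v_𝔔(x)` (`(x)² = (2)(y)`). [cite: NeukirchANT1999, Ch. I §8, Prop. (8.2)] -/
theorem even_ramificationIdx_of_sq_eq_two_mul {x y : 𝓞 N} (hx : x ^ 2 = 2 * y)
    (Q : Ideal (𝓞 N)) [hQ : Q.IsPrime] (h2 : (2 : 𝓞 N) ∈ Q) (hy : y ∉ Q) :
    Even (Q.ramificationIdx ℤ) := by
  classical
  haveI : Q.LiesOver (Ideal.span {(2 : ℤ)}) := by
    rw [Ideal.liesOver_span_iff hQ.ne_top Int.prime_two, map_ofNat]; exact h2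
  have hmap : Ideal.map (algebraMap ℤ (𝓞 N)) (Ideal.span {(2 : ℤ)}) = Ideal.span {(2 : 𝓞 N)} := by
    rw [Ideal.map_span, Set.image_singleton, map_ofNat]
  have hp0 : Ideal.map (algebraMap ℤ (𝓞 N)) (Ideal.span {(2 : ℤ)}) ≠ ⊥ :=
    Ideal.map_ne_bot_of_ne_bot (by simp)
  have h20 : (Ideal.span {(2 : 𝓞 N)} : Ideal (𝓞 N)) ≠ ⊥ := by rw [← hmap]; exact hp0
  have hy0 : (Ideal.span {y} : Ideal (𝓞 N)) ≠ ⊥ := by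
    rw [Ne, Ideal.span_singleton_eq_bot]
    rintro rfl
    exact hy Q.zero_mem
  have hx0 : (Ideal.span {x} : Ideal (𝓞 N)) ≠ ⊥ := by
    rw [Ne, Ideal.span_singleton_eq_bot]
    intro h
    have : (2 : 𝓞 N) * y = 0 := by rw [← hx, h]; ring
    rcases mul_eq_zero.mp this with h' | h'
    · exact h20 (Ideal.span_singleton_eq_bot.mpr h')
    · exact hy0 (Ideal.span_singleton_eq_bot.mpr h')
  have hcount : Multiset.count Q (normalizedFactors (Ideal.span {(2 : 𝓞 N)} : Ideal (𝓞 N))) =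
      2 * Multiset.count Q (normalizedFactors (Ideal.span {x} : Ideal (𝓞 N))) := by
    have hsq : (Ideal.span {x} : Ideal (𝓞 N)) ^ 2 = Ideal.span {(2 : 𝓞 N)} * Ideal.span {y} := by
      rw [Ideal.span_singleton_pow, hx, Ideal.span_singleton_mul_span_singleton]
    have hcy : Multiset.count Q (normalizedFactors (Ideal.span {y} : Ideal (𝓞 N))) = 0 := by
      rw [Multiset.count_eq_zero]
      intro hmem
      exact hy (Ideal.le_of_dvd (dvd_of_mem_normalizedFactors hmem) (Ideal.mem_span_singleton_self y))
    have := congrArg (fun I => Multiset.count Q (normalizedFactors I)) hsq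
    rw [normalizedFactors_pow, Multiset.count_nsmul, normalizedFactors_mul h20 hy0, Multiset.count_add,
      hcy, add_zero] at this
    exact this.symm
  rw [Ideal.IsDedekindDomain.ramificationIdx_eq_normalizedFactors_count (Ideal.span {(2 : ℤ)}) Q hp0, hmap, hcount]
  exact even_two_mul _

omit [NumberField N] in
/-- An element with square in `ℤ` is an algebraic integer. [folklore] -/
private theorem isIntegral_of_sq_eq_intCast {δ : N} {D : ℤ} (hδ : δ ^ 2 = (D : N)) : IsIntegral ℤ δ := by
  refine ⟨X ^ 2 - C D, monic_X_pow_sub_C _ two_ne_zero, ?_⟩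
  simp only [eval₂_sub, eval₂_X_pow, eval₂_C, hδ]
  simp

omit [NumberField N] in
/-- An odd integer lies in no prime ideal containing `2`. [folklore] -/
private theorem intCast_not_mem_of_odd {D : ℤ} (hD : Odd D) (Q : Ideal (𝓞 N)) [hQ : Q.IsPrime]
    (h2 : (2 : 𝓞 N) ∈ Q) : ((D : 𝓞 N)) ∉ Q := by
  obtain ⟨m, rfl⟩ := hD
  intro h
  have h2m : ((2 * m : ℤ) : 𝓞 N) ∈ Q := by
    rw [Int.cast_mul, Int.cast_ofNat]; exact Q.mul_mem_right _ h2
  have h1 : (1 : 𝓞 N) ∈ Q := by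
    have := Q.sub_mem h h2m
    simpa using this
  exact hQ.ne_top ((Ideal.eq_top_iff_one Q).mpr h1)

/-- **`√D ∈ N` with `D ≡ 3 (mod 4)` forces `e(𝔔|2)` even** for every prime `𝔔 ∋ 2` of `𝓞 N`: with `1 + D = 4k`,
`(1 + δ)² = 2·(δ + 2k)` and `δ + 2k ∉ 𝔔` (else `δ ∈ 𝔔`, `D = δ² ∈ 𝔔`, `D` odd). [cite: NeukirchANT1999, Ch. I §8, Prop. (8.2)] -/
theorem even_ramificationIdx_of_sq_eq_intCast_of_emod_four_eq_three {δ : N} {D : ℤ} (hδ : δ ^ 2 = (D : N))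
    (hD : D % 4 = 3) (Q : Ideal (𝓞 N)) [hQ : Q.IsPrime] (h2 : (2 : 𝓞 N) ∈ Q) :
    Even (Q.ramificationIdx ℤ) := by
  obtain ⟨k, hk⟩ : ∃ k : ℤ, 1 + D = 4 * k := ⟨(1 + D) / 4, by omega⟩
  set δ' : 𝓞 N := ⟨δ, isIntegral_of_sq_eq_intCast hδ⟩ with hδ'def
  have hδ' : δ' ^ 2 = (D : 𝓞 N) := by
    apply Subtype.ext
    change ((δ' ^ 2 : 𝓞 N) : N) = (((D : 𝓞 N)) : N)
    push_cast; exact hδ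
  have hx : (1 + δ') ^ 2 = 2 * (δ' + 2 * k) := by
    have : (4 : 𝓞 N) * k = 1 + D := by exact_mod_cast hk.symm
    linear_combination hδ' - this
  refine even_ramificationIdx_of_sq_eq_two_mul hx Q h2 fun hy => ?_
  have hδQ : δ' ∈ Q := by
    have h2k : (2 : 𝓞 N) * k ∈ Q := Q.mul_mem_right _ h2
    have := Q.sub_mem hy h2k
    simpa using this
  have hDQ : ((D : 𝓞 N)) ∈ Q := by rw [← hδ', sq]; exact Q.mul_mem_left _ hδQ
  exact intCast_not_mem_of_odd (by rw [Int.odd_iff]; omega) Q h2 hDQ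

/-- **`√2, √D ∈ N` with `D ≡ 3 (mod 4)` forces `4 ∣ e(𝔔|2)`** for every prime `𝔔 ∋ 2` of `𝓞 N`. With `θ² = 2`, `δ² = D`,
`1 + D = 4k`: `ξ = θ(1+δ)/2` is an algebraic integer (`ξ² = δ + 2k`), `θξ = 1 + δ`, and `(ξ − 1)² = θ·(ξ(1 − θ) + θk)` with the
cofactor outside `𝔔` (`θ ∈ 𝔔`, `1 − θ ∉ 𝔔`, and `ξ ∈ 𝔔` would give `δ ∈ 𝔔`, `D ∈ 𝔔`, `D` odd); so the local even-index certificate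
`four_dvd_ramificationIdx_of_sq_eq_mul` applies. (Locally: `ℚ₂(√2, √D)/ℚ₂` is a totally ramified biquadratic extension, all three
quadratic subfields being ramified.) [cite: NeukirchANT1999, Ch. I §8, Prop. (8.2)] [cite: Washington1997, §13.1] -/
theorem four_dvd_ramificationIdx_of_sq_eq_two_of_sq_eq_intCast {θ δ : N} {D : ℤ} (hθ : θ ^ 2 = 2)
    (hδ : δ ^ 2 = (D : N)) (hD : D % 4 = 3) (Q : Ideal (𝓞 N)) [hQ : Q.IsPrime] (h2 : (2 : 𝓞 N) ∈ Q) :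
    4 ∣ Q.ramificationIdx ℤ := by
  obtain ⟨k, hk⟩ : ∃ k : ℤ, 1 + D = 4 * k := ⟨(1 + D) / 4, by omega⟩
  have hθint : IsIntegral ℤ θ := ⟨X ^ 2 - C 2, monic_X_pow_sub_C _ two_ne_zero, by simp [hθ]⟩
  set ξ : N := θ * (1 + δ) / 2 with hξdef
  have hξ2 : ξ ^ 2 = δ + 2 * k := by
    have h4 : (4 : N) * k = 1 + D := by exact_mod_cast hk.symm
    rw [hξdef]; field_simp; linear_combination (1 + δ) ^ 2 * hθ + 2 * hδ - 2 * h4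
  have hθξ : θ * ξ = 1 + δ := by
    rw [hξdef]; field_simp; linear_combination (1 + δ) * hθ
  have hξint : IsIntegral ℤ ξ := by
    refine ⟨X ^ 4 - C (4 * k) * X ^ 2 + C (4 * k ^ 2 - D), by monicity <;> norm_num, ?_⟩
    simp only [eval₂_add, eval₂_sub, eval₂_mul, eval₂_X_pow, eval₂_C]
    simp only [eq_intCast, Int.cast_mul, Int.cast_ofNat, Int.cast_sub, Int.cast_pow]
    have : ξ ^ 4 = (δ + 2 * k) ^ 2 := by rw [← hξ2]; ring
    rw [this, hξ2]; linear_combination hδ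
  set θ' : 𝓞 N := ⟨θ, hθint⟩ with hθ'def
  set ξ' : 𝓞 N := ⟨ξ, hξint⟩ with hξ'def
  set δ' : 𝓞 N := ⟨δ, isIntegral_of_sq_eq_intCast hδ⟩ with hδ'def
  have hθ' : θ' ^ 2 = 2 := by
    apply Subtype.ext; change ((θ' ^ 2 : 𝓞 N) : N) = ((2 : 𝓞 N) : N); push_cast; exact hθ
  have hδ' : δ' ^ 2 = (D : 𝓞 N) := by
    apply Subtype.ext; change ((δ' ^ 2 : 𝓞 N) : N) = (((D : 𝓞 N)) : N); push_cast; exact hδ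
  have hξ' : ξ' ^ 2 = δ' + 2 * k := by
    apply Subtype.ext; change ((ξ' ^ 2 : 𝓞 N) : N) = ((δ' + 2 * k : 𝓞 N) : N); push_cast; exact hξ2
  have hθξ' : θ' * ξ' = 1 + δ' := by
    apply Subtype.ext; change ((θ' * ξ' : 𝓞 N) : N) = ((1 + δ' : 𝓞 N) : N); push_cast; exact hθξ
  -- the certificate `(ξ − 1)² = θ · (ξ(1 − θ) + θ k)`
  have hx : (ξ' - 1) ^ 2 = θ' * (ξ' * (1 - θ') + θ' * k) := by
    linear_combination hξ' - hθξ' + (ξ' - k) * hθ'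
  refine four_dvd_ramificationIdx_of_sq_eq_mul hθ' hx Q h2 fun hy => ?_
  -- `y ∈ 𝔔` is absurd
  have hθQ : θ' ∈ Q := by
    have : θ' ^ 2 ∈ Q := by rw [hθ']; exact h2
    exact hQ.mem_of_pow_mem 2 this
  have h1θ : 1 - θ' ∉ Q := by
    intro h
    have : (1 : 𝓞 N) ∈ Q := by simpa using Q.add_mem h hθQ
    exact hQ.ne_top ((Ideal.eq_top_iff_one Q).mpr this)
  have hξQ : ξ' ∈ Q := by
    have hprod : ξ' * (1 - θ') ∈ Q := by
      have := Q.sub_mem hy (Q.mul_mem_right (k : 𝓞 N) hθQ)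
      simpa using this
    exact (hQ.mem_or_mem hprod).resolve_right h1θ
  have hδQ : δ' ∈ Q := by
    have h1 : ξ' ^ 2 ∈ Q := by rw [sq]; exact Q.mul_mem_left _ hξQ
    rw [hξ'] at h1
    have := Q.sub_mem h1 (Q.mul_mem_right (k : 𝓞 N) h2)
    simpa using this
  have hDQ : ((D : 𝓞 N)) ∈ Q := by rw [← hδ', sq]; exact Q.mul_mem_left _ hδQ
  exact intCast_not_mem_of_odd (by rw [Int.odd_iff]; omega) Q h2 hDQ

end Elements

/-! ## §2 Inertia groups: `|I(𝔔)| = e`, restriction of scalars, and the product inequality over two generating subextensions -/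

section Inertia

variable {K M : Type*} [Field K] [NumberField K] [Field M] [NumberField M] [Algebra K M]

/-- **`#I_𝔔 = e(𝔔 | 𝔔 ∩ 𝓞_K)`** for a Galois extension `M/K` of number fields and a prime `𝔔` of `𝓞_M` (Mathlib's
`Ideal.card_inertia_eq_ramificationIdxIn` + `ramificationIdxIn_eq_ramificationIdx`). [cite: NeukirchANT1999, Ch. I §9, Prop. (9.6)] -/
theorem card_inertia_eq_ramificationIdx [IsGalois K M] (𝔔 : Ideal (𝓞 M)) [𝔔.IsPrime] :
    Nat.card (𝔔.inertia (M ≃ₐ[K] M)) = 𝔔.ramificationIdx (𝓞 K) := by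
  haveI : Module.Finite (𝓞 K) (𝓞 M) := IsIntegralClosure.finite (𝓞 K) K M (𝓞 M)
  have h := Ideal.card_inertia_eq_ramificationIdxIn (G := M ≃ₐ[K] M) (𝔔.under (𝓞 K)) 𝔔
  rwa [Ideal.ramificationIdxIn_eq_ramificationIdx (𝔔.under (𝓞 K)) 𝔔 (M ≃ₐ[K] M)] at h

variable {F : Type*} [Field F] [Algebra F K] [Algebra F M] [IsScalarTower F K M]

omit [NumberField K] [NumberField M] in
/-- Restriction of scalars does not change the action on `𝓞_M`: an element of the inertia group of `𝔔` in `Gal(M/K)` restricts to an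
element of the inertia group of `𝔔` in `Gal(M/F)` (`F ⊆ K ⊆ M`). [cite: NeukirchANT1999, Ch. I §9 (inertia group, definition)] -/
theorem restrictScalars_mem_inertia {𝔔 : Ideal (𝓞 M)} {σ : M ≃ₐ[K] M} (hσ : σ ∈ 𝔔.inertia (M ≃ₐ[K] M)) :
    σ.restrictScalars F ∈ 𝔔.inertia (M ≃ₐ[F] M) := by
  rw [Ideal.inertia, AddSubgroup.mem_inertia] at hσ ⊢
  intro x
  have h := hσ x
  have hx : (σ.restrictScalars F) • x = σ • x := Subtype.ext rfl
  rw [hx]; exact h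

end Inertia

section InertiaProduct

variable {F L T M : Type*} [Field F] [NumberField F] [Field L] [NumberField L] [Field T] [NumberField T]
  [Field M] [NumberField M] [Algebra F L] [Algebra F T] [Algebra F M] [Algebra L M] [Algebra T M]
  [IsScalarTower F L M] [IsScalarTower F T M]

/-- **PRODUCT INEQUALITY FOR RAMIFICATION INDICES OVER TWO GENERATING SUBEXTENSIONS.** Let `M/F` be a Galois extension of number
fields and `L, T` intermediate extensions which together generate `M` (an `F`-automorphism of `M` fixing `L` and `T` pointwise is the
identity). Then for every prime `𝔔` of `𝓞_M`: `e(𝔔 | 𝔔∩L) · e(𝔔 | 𝔔∩T) ≤ e(𝔔 | 𝔔∩F)`. Proof: the inertia groups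
`I_L ≤ Gal(M/L)`, `I_T ≤ Gal(M/T)` of `𝔔` map into `I_F ≤ Gal(M/F)` by restriction of scalars, the images meet trivially
(`Gal(M/L) ∩ Gal(M/T) = 1`), so `I_L × I_T → I_F`, `(σ, τ) ↦ στ` is injective; and `#I = e` (Hilbert theory).
[cite: NeukirchANT1999, Ch. I §9, Prop. (9.6) and (9.4)] -/
theorem ramificationIdx_mul_ramificationIdx_le_of_generate [IsGalois F M]
    (hgen : ∀ σ : M ≃ₐ[F] M, (∀ x : L, σ (algebraMap L M x) = algebraMap L M x) →
      (∀ y : T, σ (algebraMap T M y) = algebraMap T M y) → σ = 1)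
    (𝔔 : Ideal (𝓞 M)) [𝔔.IsPrime] :
    𝔔.ramificationIdx (𝓞 L) * 𝔔.ramificationIdx (𝓞 T) ≤ 𝔔.ramificationIdx (𝓞 F) := by
  haveI : IsGalois L M := IsGalois.tower_top_of_isGalois F L M
  haveI : IsGalois T M := IsGalois.tower_top_of_isGalois F T M
  haveI : FiniteDimensional F M := Module.Finite.of_restrictScalars_finite ℚ F M
  rw [← card_inertia_eq_ramificationIdx (K := L) 𝔔, ← card_inertia_eq_ramificationIdx (K := T) 𝔔,
    ← card_inertia_eq_ramificationIdx (K := F) 𝔔, ← Nat.card_prod]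
  -- the multiplication map
  let φ : 𝔔.inertia (M ≃ₐ[L] M) × 𝔔.inertia (M ≃ₐ[T] M) → 𝔔.inertia (M ≃ₐ[F] M) := fun p =>
    ⟨p.1.1.restrictScalars F * p.2.1.restrictScalars F,
      mul_mem (restrictScalars_mem_inertia p.1.2) (restrictScalars_mem_inertia p.2.2)⟩
  refine Nat.card_le_card_of_injective φ ?_
  rintro ⟨⟨σ₁, hσ₁⟩, ⟨τ₁, hτ₁⟩⟩ ⟨⟨σ₂, hσ₂⟩, ⟨τ₂, hτ₂⟩⟩ h
  have h' : σ₁.restrictScalars F * τ₁.restrictScalars F = σ₂.restrictScalars F * τ₂.restrictScalars F :=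
    congrArg Subtype.val h
  -- `ρ = σ₂⁻¹ σ₁ = τ₂ τ₁⁻¹` fixes `L` and `T`
  set ρ : M ≃ₐ[F] M := (σ₂.restrictScalars F)⁻¹ * σ₁.restrictScalars F with hρ
  have hρ' : ρ = τ₂.restrictScalars F * (τ₁.restrictScalars F)⁻¹ := by
    rw [hρ, inv_mul_eq_iff_eq_mul, ← mul_assoc, eq_mul_inv_iff_mul_eq]; exact h'
  have hρL : ∀ x : L, ρ (algebraMap L M x) = algebraMap L M x := by
    intro x
    rw [hρ, AlgEquiv.mul_apply, AlgEquiv.aut_inv]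
    change σ₂.symm (σ₁ (algebraMap L M x)) = algebraMap L M x
    rw [σ₁.commutes, ← σ₂.commutes x, σ₂.symm_apply_apply, σ₂.commutes]
  have hρT : ∀ y : T, ρ (algebraMap T M y) = algebraMap T M y := by
    intro y
    rw [hρ', AlgEquiv.mul_apply, AlgEquiv.aut_inv]
    change τ₂ (τ₁.symm (algebraMap T M y)) = algebraMap T M y
    rw [← τ₁.commutes y, τ₁.symm_apply_apply, τ₁.commutes, τ₂.commutes]
  have hρ1 : ρ = 1 := hgen ρ hρL hρT
  have hσ : σ₁ = σ₂ := by
    apply AlgEquiv.restrictScalars_injective F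
    have : (σ₂.restrictScalars F)⁻¹ * σ₁.restrictScalars F = 1 := by rw [← hρ]; exact hρ1
    rw [inv_mul_eq_one] at this
    exact this.symm
  have hτ : τ₁ = τ₂ := by
    apply AlgEquiv.restrictScalars_injective F
    have : τ₂.restrictScalars F * (τ₁.restrictScalars F)⁻¹ = 1 := by rw [← hρ']; exact hρ1
    rw [mul_inv_eq_one] at this
    exact this.symm
  subst hσ hτ
  rfl

end InertiaProduct

/-! ## §3 Transport of `e(·|2)` along an isomorphism of rings of integers -/

section Transport

variable {K L : Type*} [Field K] [NumberField K] [Field L] [NumberField L]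

/-- **`e(ε(P)|2) = e(P|2)` along a ring isomorphism `ε : 𝓞_K ≃ 𝓞_L`** (every ring isomorphism is a `ℤ`-algebra isomorphism; Mathlib
`Ideal.ramificationIdx'_map_eq`). Phrased with `ε` on the rings of integers so that no field-structure unification is needed.
[cite: NeukirchANT1999, Ch. I §8 (8.2)] -/
theorem ramificationIdx_int_map_ringEquiv (ε : 𝓞 K ≃+* 𝓞 L) (P : Ideal (𝓞 K)) [hP : P.IsPrime] (hP0 : P ≠ ⊥) :
    (P.map ε).ramificationIdx ℤ = P.ramificationIdx ℤ := by
  let εℤ : 𝓞 K ≃ₐ[ℤ] 𝓞 L := AlgEquiv.ofRingEquiv (f := ε) (fun x => by simp)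
  have hmap : P.map ε = P.map εℤ := rfl
  set p : Ideal ℤ := P.under ℤ with hp
  haveI : P.LiesOver p := ⟨rfl⟩
  haveI : (P.map εℤ).IsPrime := Ideal.map_isPrime_of_equiv εℤ
  haveI : (P.map εℤ).LiesOver p := by
    constructor
    rw [hp, Ideal.under_def, Ideal.under_def,
      show P.map εℤ = P.comap ((εℤ : 𝓞 K ≃+* 𝓞 L).symm : 𝓞 L →+* 𝓞 K) from (Ideal.comap_symm (εℤ : 𝓞 K ≃+* 𝓞 L)).symm,
      Ideal.comap_comap]
    congr 1
    ext x
    simp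
  have hp0 : p ≠ ⊥ := fun h => hP0 (Ideal.eq_bot_of_comap_eq_bot h)
  rw [hmap, ← Ideal.ramificationIdx'_eq_ramificationIdx p (P.map εℤ) hp0, ← Ideal.ramificationIdx'_eq_ramificationIdx p P hp0]
  exact Ideal.ramificationIdx'_map_eq p P εℤ

/-- **Transport of a bound on `e(·|2)` along `𝓞_K ≃ 𝓞_L`**: if every prime `P ∋ 2` of `𝓞_L` has `e(P|2) ≤ n`, then so does every prime
`P ∋ 2` of `𝓞_K`. [cite: NeukirchANT1999, Ch. I §8 (8.2)] -/
theorem forall_ramificationIdx_le_of_ringEquiv (ε : 𝓞 K ≃+* 𝓞 L) {n : ℕ}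
    (hL : ∀ P : Ideal (𝓞 L), P.IsPrime → (2 : 𝓞 L) ∈ P → P.ramificationIdx ℤ ≤ n) :
    ∀ P : Ideal (𝓞 K), P.IsPrime → (2 : 𝓞 K) ∈ P → P.ramificationIdx ℤ ≤ n := by
  intro P hP h2P
  have hP0 : P ≠ ⊥ := fun h => by rw [h, Ideal.mem_bot] at h2P; exact two_ne_zero h2P
  haveI : (P.map ε).IsPrime := Ideal.map_isPrime_of_equiv ε
  have h2' : (2 : 𝓞 L) ∈ P.map ε := by
    have := Ideal.mem_map_of_mem ε h2P
    rwa [map_ofNat] at this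
  have h := hL _ inferInstance h2'
  rwa [ramificationIdx_int_map_ringEquiv ε P hP0] at h

end Transport

end Summit.BirchSwinnertonDyer.BirchSwinnertonDyer.Theorems.AlignedTransportAtTwoCubicOffStratumFukudaIndexTools

end
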